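/-
Copyright: cell gate-hubbard-kl, typer seat t6 (D-0069 (2) B1 statement-typer wave). Statement-level skeleton of a
published text; nothing here is a claim about the Hubbard model or about superconductivity.
-/
import Mathlib
import Literature.MathematicalPhysics.QuantumLattice.FermiRG.DR2000PartI
import HarnessLib

/-!
# Disertori–Rivasseau 2000, Part II «Renormalization»: the finite-temperature Fermi-liquid theorem for two-dimensional
jellium (Theorem 1), the renormalized expansion and the self-energy bounds (Theorem 2), convergence (Theorem 3), and the
flow of the chemical-potential counterterm (App. A, Lemmas 6–8)

M. Disertori, V. Rivasseau, *Interacting Fermi liquid in two dimensions at finite temperature. Part II: Renormalization*,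
Commun. Math. Phys. **215** (2000) 291–341, arXiv:cond-mat/9907131 [DisertoriRivasseau2000b].  Render
`paper:arxiv-cond-mat_9907131` (corpus TeX, 19 chunks; LOCATOR `pNNNN:Lm` = chunk:line, not a printed page).  Builds on
`FermiRG/DR2000PartIModel.lean`, `FermiRG/DR2000PartI.lean` ([DR1] = [DisertoriRivasseau2000]).  Cell rows: DR2.T1 = F-053,
DR2.T2 = F-056, DR2.T3 = F-057, DR2.L6 = F-061, DR2.L7 = F-062, DR2.L8 = F-063 (REQUIRED); DR2.L3 = F-058, DR2.L9 = F-064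
(optional, typed); DR2.L1, L2, L4, L5, L10, L11 not typed (below).  ISOTROPIC JELLIUM in `d = 2` at `T > 0`; nothing here
is about a lattice model, and nothing asserts or denies any statement about the Hubbard model.

WHAT IS PRINTED (render).  p0001:L18–24 abstract: «a two-dimensional jellium system of interacting Fermions at low
temperature T is a Fermi liquid above the BCS temperature. Following [S1], this means proving analyticity in the coupling
constant λ for |λ||log T| ≤ K … and some uniform bounds on the derivatives of the self-energy».  §II p0003:L56–64 (II.4)
«S_V = (λ/2)∫_V d³x (Σ_a ψ̄ψ)² + δμ¹_Λ ∫_V d³x Σ_a ψ̄ψ, where λ is the bare coupling constant and δμ¹_Λ is the bare chemical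
potential counterterm, function of the ultraviolet cut-off Λ₀ = 1 and the infrared cut-off Λ. The free covariance is
Ĉ_{ab}(k) = δ_{ab}/(ik₀ − k⃗² − μ) [sic; [DR1] (II.2)–(II.3): 1/(ik₀ − e(k⃗)), e = k⃗² − 1], where μ = 1 is the renormalized
chemical potential and 2m = 1.»  (II.6) L65–83 «The BPHZ condition states δμ_ren(Λ) = δμ^Λ_Λ = Σ̂^Λ(k_F) = ∫d³x
e^{−ik_Fx} Σ^Λ(0,x) = 0 where Σ^Λ is the two point vertex function Γ₂^{Λ₀,Λ} (Λ₀ = 1), k_F … as near as possible to the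
Fermi surface … |k_{F0}| = πT and |k⃗_F| = 1 … By rotation invariance, this condition does not depend on the angular part
of k⃗_F».  **Theorem 1** p0003:L86–98 «The limit Λ → 0 of Γ^{ΛΛ₀}_{2p}(φ₁,…,φ_{2p}) is analytic in the bare coupling
constant λ, for all values of λ ∈ ℂ such that |λ| ≤ c, with c given by the equivalent relations T = K₁e^{−1/(cK₂)};
c = 1/(K₂|log T/K₁|) for some constants K₁ and K₂ (this relation being limited to the interesting low temperature regime
T/K₁ < 1).»  §II.3 (II.9) p0006:L28–37 «δ(k₁+k₂) τ_g ĝ(k₂) = δ(k₁+k₂) ĝ(k_F) … k_{F0} = πT»; §II.4 (II.10) p0006:L92–99 the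
dual operator «τ_g^* C_{θ₁}(x₁,y₁)C_{θ₂}(x₂,y₂) = e^{ir₂(x₂−x₁)} C_{θ₁}(x₁,y₁)C_{θ₂}(x₁,y₂)», r₂ = (πT, r⃗₂).  **Theorem 2**
p0007:L26–106: applying (1−τ_g)+τ_g to every g ∈ D(𝒞,P) rewrites Γ^{Λ₀}_{2p} as the renormalized expansion (II.15) with
effective constants δμ^{Λ(w_{i_v})}_Λ(λ) at the two-point vertices, «where δμ^{Λ(w)}_Λ(λ) := Σ̂^{Λ(w)}(−r₂) = ∫d³x₂
Σ^{Λ(w)}(0,x₂)e^{ir₂x₂} is independent of the choice of the angular component of r⃗₂ … is the vertex function Γ₂^{1Λ(w)} for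
an effective theory with IR parameter Λ(w), and bare counterterm δμ¹_Λ. Furthermore δμ^{Λ(w)}_Λ(λ) is analytic in λ and is
bounded by |δμ^{Λ(w)}_Λ(λ)| ≤ K|λ|(Λ(w) − Λ) for some constant K. The renormalized δμ_ren(Λ) is … δμ^Λ_Λ(λ) = 0. Finally
the first and second derivatives of the self-energy Σ̂(k) [the sum of all non-trivial 1PI two point subgraphs] are
uniformly bounded: |∂Σ̂/∂k_i |_{k₀=π/β, e(k⃗)=0}| ≤ K|λ|²; ‖∂²Σ̂/∂k_i∂k_j(k)‖_∞ ≤ K where i and j take values 0,1,2, and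
K is some constant. These bounds are proved in Appendix B.»; L120–123 «the bound of the first and second derivatives of
the self-energy allows a Taylor expansion around the Fermi surface which proves Fermi liquid behavior [S1]; they would be
false in d = 1».  **Theorem 3** p0007:L127–163 «Let ε > 0 and Λ₀ = 1 be fixed. The series (II.15) is absolutely convergent
for |λ| ≤ c and c ≤ 1/(K₂|log(T/K₁)|) for some constants K₁, K₂. This convergence is uniform in Λ, then the IR limits of
the vertex functions Γ^{Λ₀}_{2p} = lim_{Λ→0}Γ^{ΛΛ₀}_{2p} exist, they are analytic in λ in a disk of radius c, and they obey the
bounds |Γ^{Λ₀}_{2p>4}| ≤ K₀‖φ₁‖_{L₁}∏_{i=2}^{2p}‖φ̂_i‖_{∞,2} T^{7p/2 − 1/2}(1/(2p−4))[K₁(ε)]^p (p!)² K(c,T) e^{−(1−ε)Λ_T^{1/s}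
d_𝒯^{1/s}(Ω₁,…,Ω_{2p})}; |Γ^{Λ₀}_4| ≤ K₀'(ε)‖φ₁‖_{L₁}∏_{i=2}^{4}‖φ̂_i‖_{∞,2} T^{13/2} K(c,T) e^{−…}; |Γ^{Λ₀}_2| ≤ K₀''(ε)‖φ₁‖_{L₁}
‖φ̂₂‖_{∞,2} T² K(c,T) e^{−…} where Ω_i is the compact support of φ_i, K₁(ε), K₀'(ε) and K₀''(ε) are functions of ε only,
d_𝒯 … as in [DR1], Theorem 2, K(c,T) is a function which tends to 0 when c → 0, and ‖φ̂_i‖_{∞,2} := ‖φ̂_i‖_∞ + ‖φ̂'_i‖_∞ +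
‖φ̂''_i‖_∞.» (exponent render «T^7p2 -122p-4» = T^{7p/2−1/2}/(2p−4), cf. (II.48) p0014:L60 «w_T^{7p/4−1/4}/(2p−4)»).
App. A p0014:L76–96: «Σ[δμ, C]» = the 1PI two-point vertex function with at least one internal line at external momentum
k_F for bare counterterm δμ and propagator C; (A.1) «δμ¹_Λ(λ) = Σ[δμ¹_Λ(λ), C¹_Λ]», (A.2) «δμ^{Λ'}_Λ(λ) = δμ¹_Λ(λ) −
Σ[δμ¹_Λ(λ), C¹_{Λ'}], Λ ≤ Λ' ≤ 1»; (A.4) p0014:L150–151 «H(Λ): |δμ^{Λ'}_Λ(λ)| ≤ K₁|λ|(Λ' − Λ) ∀ Λ' ≥ Λ», to be proved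
«∀ 0 ≤ Λ ≤ 1».  **Lemma 6** p0014:L167–172 «If H(Λ) is true then the derivative (d/dΛ)δμ¹_Λ(λ), Λ ≤ Λ' ≤ 1 exists and
satisfies the bounds: |(d/dΛ)δμ¹_Λ(λ)| ≤ K₂|λ|.»  **Lemma 7** p0015:L102–106 «If H(Λ) is true then the derivative
(d/dΛ)δμ^{Λ'}_Λ(λ) exists and satisfies the bound: |(d/dΛ)δμ^{Λ'}_Λ(λ)| ≤ K₃|λ|.»  **Lemma 8** p0015:L125–129 «If the bound
|δμ^{Λ'}_Λ| ≤ K₁|λ|(Λ' − Λ) is true for all Λ' ≥ Λ'₀ = Λ + ε then it is true for Λ'₀ − ε' for ε' < ε small enough.»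
§II.7 **Lemma 3** p0008:L175–183 / proof p0009:L1–42: the component orthogonal to r⃗₂ of the first-order Taylor term
vanishes, because ĝ(k) depends only on k₀ and |k⃗|: «[∂ĝ/∂k_t(r₂)]|_{k=−r₂} = 0».  App. B1 **Lemma 9** p0016:L116–140: with
a₁ = m₁, a_r(s₁..s_{r−1}) = m_r + s_{r−1}a_{r−1}, «∫₀¹∏₁^q ds_r ∏_{r=1}^q a_r(s₁,…,s_{r−1}) ≤ e^{Σ_{r=1}^q m_r}» (no factorial
from arch systems).

WHAT IS TYPED, AND HOW.  * Concrete: the renormalization point `kF T θ = (πT, (cos θ, sin θ))`, the momentum-space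
localization `tauMom` (II.9), the dual operator `tauDual` (II.10), the norm `supNorm2` = ‖·‖_{∞,2} (first/second Fréchet
derivatives in the sup norm of `ℝ × ℝ²`; constants immaterial), coordinate derivatives `pderiv`/`pderiv2` along
(k₀, k₁, k₂).  * The renormalized vertex functions, the effective constants and the self-energy are NOT constructed:
`RenormalizedData` carries `Γ^{ΛΛ₀}_{2p}` (with the BPHZ counterterm), the majorant terms of (II.15), `δμ^{Λ'}_Λ(λ)` and
`Σ̂^Λ(λ;k)` as data; **Theorems 1, 2, 3** are the PREDICATES `ThmII1Shape`, `ThmII2Shape`, `ThmII3Shape` on a family `T ↦ data`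
(constants K₁, K₂, K, K₀… uniform in T as printed: «functions of ε only», «some constants»), NOT asserted, no fact debt;
the combinatorial identity (II.15) of Theorem 2 («a reshuffling of perturbation theory») is docstring-level; the typed
clauses of Theorem 2 are (II.17) analyticity and bound of δμ, (II.18), and the derivative bounds (II.19) — first
derivatives AT the points (πT, |k⃗| = 1), second derivatives as a global sup, uniformly in Λ ∈ (0,1] and in the disc of
Theorem 1.  * App. A: `CountertermFlowData` carries Σ[δμ, C¹_{Λ'}](λ) and δμ¹_Λ(λ) as data; (A.1) is the predicate `BPHZ`,
(A.2) the definition `effConst`, H(Λ) the predicate `HProp`; **Lemmas 6, 7, 8** are the predicates `Lemma6Shape`,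
`Lemma7Shape`, `Lemma8Shape` (derivatives in Λ of `ℝ → ℂ` maps via `HasDerivWithinAt` on the printed Λ-ranges), in a disc
|λ| ≤ c left as a parameter
(the print's standing «λ small enough»).  * **Lemma 3** is typed by its momentum-space core and PROVED
(`tangentialDeriv_eq_zero_of_rotationInvariant`): a function of (k₀, |k⃗|) has zero derivative along the tangential
direction at every point — the printed «[∂ĝ/∂k_t]_{k=−r₂} = 0».  * **Lemma 9** is the closed named fact `Lemma9ArchSystems`
(the printed inequality with `a_r` defined by the printed recursion, `m_r ≥ 0`).

LOCATOR ERRATUM (rev 2): the first landing (p415091) printed chunk:line locators for p0003, p0005, p0007 with the line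
offset of a concatenated two-chunk view (+44, +125, +127 respectively); corrected here, statements unchanged.

NOT TYPED (optional rows, reasons).  Lemma 1 (p0005:L39, «the same Gram inequality as [DR1] (IV.4)» for the
s-interpolated matrix), Lemma 2 (p0005:L71, |P| ≤ K^{n̄}), Lemmas 4, 10, 11 (p0012:L41, p0018:L94, p0019:L6: modified sector
counts / volume factors for specific four-point subgraphs on the chains C^r, C'^r), Lemma 5 (p0013:L145, x_i ≥ |et_i|/88
for |eg_i| > 6): statements about the loop-extraction process P, the chains and the exponents of THIS proof, with no
object outside it; recorded here by locator only.  The closed forms of Theorems 1–3 / Lemmas 6–8 need the renormalized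
CTS expansion (II.15) and Σ[δμ, C] as Lean objects (cell GAP-LEDGER).
-/

noncomputable section

open MeasureTheory Complex Filter
open scoped Topology BigOperators

namespace Literature.MathematicalPhysics.QuantumLattice.FermiRG.DR2000

open Literature.MathematicalPhysics.QuantumLattice

/-! ## §II The renormalization point, the localization operators, the norm ‖·‖_{∞,2} -/

/-- The renormalization point `k_F = (πT, k⃗_F)`, `|k⃗_F| = 1` («the Fermi surface cannot be reached at finite temperature
… hence with |k_{F0}| = πT and |k⃗_F| = 1»; any direction `θ` by rotation invariance).
[cite: DisertoriRivasseau2000b, §II (II.6) p0003:L67–79] -/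
def kF (T θ : ℝ) : Mom := (Real.pi * T, ![Real.cos θ, Real.sin θ])

/-- The momentum-space localization operator on two-point functions: `(τ_g ĝ)(k) = ĝ(k_F)`.
[cite: DisertoriRivasseau2000b, §II.3 (II.9) p0006:L28–37] -/
def tauMom (T θ : ℝ) (g : Mom → ℂ) : Mom → ℂ := fun _ => g (kF T θ)

/-- The dual (position-space) localization operator acting on the two external propagators of a two-point subgraph:
`τ_g^*[C_{θ₁}(x₁,y₁)C_{θ₂}(x₂,y₂)] = e^{ir₂(x₂−x₁)} C_{θ₁}(x₁,y₁) C_{θ₂}(x₁,y₂)` (reference vertex x₁, moved vertex x₂,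
r₂ = (πT, r⃗₂) the centre of the sector of the second line). [cite: DisertoriRivasseau2000b, §II.4 (II.10) p0006:L92–99] -/
def tauDual (r₂ : Mom) (C₁ C₂ : Mom → Mom → ℂ) (x₁ y₁ x₂ y₂ : Mom) : ℂ :=
  Complex.exp ((pairing r₂ (x₂ - x₁) : ℂ) * Complex.I) * C₁ x₁ y₁ * C₂ x₁ y₂

/-- `‖φ̂‖_{∞,2} := ‖φ̂‖_∞ + ‖φ̂'‖_∞ + ‖φ̂''‖_∞` (first and second Fréchet derivatives on `ℝ × ℝ²`, sup norms as `⨆`).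
[cite: DisertoriRivasseau2000b, §II.6 Theorem 3 (II.22) p0007:L162–163] -/
def supNorm2 (f : Mom → ℂ) : ℝ :=
  supNorm f + (⨆ k : Mom, ‖fderiv ℝ f k‖) + ⨆ k : Mom, ‖iteratedFDeriv ℝ 2 f k‖

/-- `‖φ₁‖_{L₁} ∏_{i=2}^{2p} ‖φ̂_i‖_{∞,2}`. [cite: DisertoriRivasseau2000b, §II.6 Theorem 3 (II.21) p0007:L138–157] -/
def testNormProduct2 {m : ℕ} (φ : Fin m → TestFn) : ℝ :=
  ∏ i : Fin m, if (i : ℕ) = 0 then l1Norm (φ i) else supNorm2 (hat (φ i))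

/-- The coordinate directions `k₀, k₁, k₂` of `ℝ × ℝ²`. [cite: DisertoriRivasseau2000b, §II.5 (II.19) p0007:L97–105] -/
def basisMom (i : Fin 3) : Mom := if (i : ℕ) = 0 then (1, 0) else (0, Pi.single (⟨(i : ℕ) - 1, by omega⟩ : Fin 2) 1)

/-- `∂f/∂k_i`. [cite: DisertoriRivasseau2000b, §II.5 (II.19) p0007:L97–105] -/
def pderiv (i : Fin 3) (f : Mom → ℂ) (k : Mom) : ℂ := fderiv ℝ f k (basisMom i)

/-- `∂²f/∂k_i∂k_j`. [cite: DisertoriRivasseau2000b, §II.5 (II.19) p0007:L97–105] -/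
def pderiv2 (i j : Fin 3) (f : Mom → ℂ) (k : Mom) : ℂ := pderiv i (pderiv j f) k

/-! ## Theorems 1, 2, 3 as hypothesis shapes on renormalized-expansion data -/

/-- The renormalized theory at one temperature as DATA (not constructed here; Λ₀ = 1): `gamma p Λ λ φ` stands for
`Γ^{ΛΛ₀}_{2p}(φ₁,…,φ_{2p})` of the model (II.4)–(II.6) (bare counterterm δμ¹_Λ fixed by BPHZ); `absTerm p Λ φ n̄` for the
order-n̄ term of the majorant of the renormalized expansion (II.15)/(II.23) (coefficient of |λ|^{n̄}: the powers of δμ are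
bounded through (II.17)); `deltaMuEff Λ' Λ λ` for the effective constant `δμ^{Λ'}_Λ(λ)` at scale `Λ' = Λ(w)` (II.16);
`sigmaHat Λ λ k` for the self-energy `Σ̂^Λ(k)` (sum of the non-trivial 1PI two-point subgraphs) as a function of a
continuous three-momentum. [cite: DisertoriRivasseau2000b, §II (II.4)–(II.7), (II.15)–(II.19) p0003:L56–116, p0007:L26–106] -/
structure RenormalizedData where
  /-- `Γ^{ΛΛ₀}_{2p}` smeared with `2p` test functions. -/
  gamma : (p : ℕ) → ℝ → ℂ → (Fin (2 * p) → TestFn) → ℂ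
  /-- the order-`n̄` majorant term of (II.15). -/
  absTerm : (p : ℕ) → ℝ → (Fin (2 * p) → TestFn) → ℕ → ℝ
  /-- `δμ^{Λ'}_Λ(λ)`. -/
  deltaMuEff : ℝ → ℝ → ℂ → ℂ
  /-- `Σ̂^Λ(λ; k)`. -/
  sigmaHat : ℝ → ℂ → Mom → ℂ
  absTerm_nonneg : ∀ (p : ℕ) (Λ : ℝ) (φ : Fin (2 * p) → TestFn) (n : ℕ), 0 ≤ absTerm p Λ φ n
  norm_gamma_le : ∀ (p : ℕ) (Λ : ℝ) (lam : ℂ) (φ : Fin (2 * p) → TestFn),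
    Summable (fun n : ℕ => ‖lam‖ ^ n * absTerm p Λ φ n) → ‖gamma p Λ lam φ‖ ≤ ∑' n : ℕ, ‖lam‖ ^ n * absTerm p Λ φ n

/-- The radius of Theorem 1: `c = 1/(K₂ |log(T/K₁)|)` (⟺ `T = K₁e^{−1/(cK₂)}`), for `T < K₁`.
[cite: DisertoriRivasseau2000b, §II Theorem 1 (II.7) p0003:L92–98] -/
def radiusOfT (K₁ K₂ T : ℝ) : ℝ := 1 / (K₂ * |Real.log (T / K₁)|)

/-- The radius is positive in the low-temperature regime `0 < T < K₁` («T/K₁ < 1»).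
[cite: DisertoriRivasseau2000b, §II Theorem 1 (II.7) p0003:L97–98] -/
theorem radiusOfT_pos {K₁ K₂ T : ℝ} (hK₂ : 0 < K₂) (hT : 0 < T) (hTK : T < K₁) : 0 < radiusOfT K₁ K₂ T := by
  unfold radiusOfT
  have hK₁ : 0 < K₁ := hT.trans hTK
  have hlog : Real.log (T / K₁) < 0 := Real.log_neg (div_pos hT hK₁) ((div_lt_one hK₁).2 hTK)
  have : 0 < |Real.log (T / K₁)| := abs_pos.2 hlog.ne
  positivity

/-- **Theorem 1 (shape, constants explicit)** — the finite-temperature Fermi-liquid theorem for `d = 2` jellium, on a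
family `T ↦ data`, with radius constants `K₁, K₂`: for every temperature `0 < T < K₁`, with `c = 1/(K₂|log(T/K₁)|)`, for all
`2p ≥ 2` admissible test functions the limit `Λ → 0` of `Γ^{ΛΛ₀}_{2p}(φ₁,…,φ_{2p})` exists for every `|λ| ≤ c` and is
holomorphic in `λ` on the open disc of radius `c`.  Predicate, NOT asserted.  (The jellium counterterm δμ is part of the
model; by rotation invariance it is a number, so no dispersion-inversion problem arises — unlike a lattice dispersion.)
[cite: DisertoriRivasseau2000b, §II Theorem 1 p0003:L86–98] -/
def ThmII1ShapeWith (K₁ K₂ : ℝ) (D : ℝ → RenormalizedData) : Prop :=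
  ∀ T : ℝ, 0 < T → T < K₁ →
    ∀ (p : ℕ), 1 ≤ p → ∀ φ : Fin (2 * p) → TestFn, (∀ i, IsTestFn (φ i)) →
      ∃ G : ℂ → ℂ, DifferentiableOn ℂ G (Metric.ball 0 (radiusOfT K₁ K₂ T)) ∧
        ∀ lam : ℂ, ‖lam‖ ≤ radiusOfT K₁ K₂ T →
          Tendsto (fun Λ : ℝ => (D T).gamma p Λ lam φ) (𝓝[>] 0) (𝓝 (G lam))

/-- **Theorem 1 (shape)**: `ThmII1ShapeWith K₁ K₂` «for some constants K₁ and K₂».  Predicate, NOT asserted.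
[cite: DisertoriRivasseau2000b, §II Theorem 1 p0003:L86–98] -/
def ThmII1Shape (D : ℝ → RenormalizedData) : Prop :=
  ∃ K₁ K₂ : ℝ, 0 < K₁ ∧ 0 < K₂ ∧ ThmII1ShapeWith K₁ K₂ D

/-- **Theorem 2 (shape), analytic clauses** (II.17)–(II.19), in the regime of Theorem 1 with radius constants `K₁, K₂`:
one constant `K` such that for all `0 < T < K₁` and `|λ| ≤ c(T)`: (a) `λ ↦ δμ^{Λ'}_Λ(λ)` is holomorphic on the open disc and
`|δμ^{Λ'}_Λ(λ)| ≤ K|λ|(Λ' − Λ)` for `0 < Λ ≤ Λ' ≤ 1`; (b) the BPHZ normalisation `δμ^Λ_Λ(λ) = 0`; (c) at every point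
`k = (πT, k⃗)`, `|k⃗| = 1`: `|∂Σ̂^Λ/∂k_i| ≤ K|λ|²`, and `|∂²Σ̂^Λ/∂k_i∂k_j(k)| ≤ K` for ALL `k`, `i, j ∈ {0,1,2}`, uniformly in
`Λ ∈ (0,1]`.  The combinatorial identity (II.15) is not typed.  Predicate, NOT asserted.
[cite: DisertoriRivasseau2000b, §II.5 Theorem 2 (II.15)–(II.19) p0007:L26–123] -/
def ThmII2Shape (K₁ K₂ : ℝ) (D : ℝ → RenormalizedData) : Prop :=
  ∃ K : ℝ, 0 < K ∧ ∀ T : ℝ, 0 < T → T < K₁ →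
    (∀ Λ Λ' : ℝ, 0 < Λ → Λ ≤ Λ' → Λ' ≤ 1 →
        DifferentiableOn ℂ (fun lam => (D T).deltaMuEff Λ' Λ lam) (Metric.ball 0 (radiusOfT K₁ K₂ T)) ∧
          ∀ lam : ℂ, ‖lam‖ ≤ radiusOfT K₁ K₂ T → ‖(D T).deltaMuEff Λ' Λ lam‖ ≤ K * ‖lam‖ * (Λ' - Λ)) ∧
    (∀ Λ : ℝ, 0 < Λ → Λ ≤ 1 → ∀ lam : ℂ, ‖lam‖ ≤ radiusOfT K₁ K₂ T → (D T).deltaMuEff Λ Λ lam = 0) ∧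
    (∀ Λ : ℝ, 0 < Λ → Λ ≤ 1 → ∀ lam : ℂ, ‖lam‖ ≤ radiusOfT K₁ K₂ T →
        (∀ (θ : ℝ) (i : Fin 3), ‖pderiv i ((D T).sigmaHat Λ lam) (kF T θ)‖ ≤ K * ‖lam‖ ^ 2) ∧
          ∀ (k : Mom) (i j : Fin 3), ‖pderiv2 i j ((D T).sigmaHat Λ lam) k‖ ≤ K)

/-- The printed right-hand sides of (II.21) (`p = 1, 2`, `2p > 4`) with `Λ_T = √2πT`, `KcT = K(c,T)`.
[cite: DisertoriRivasseau2000b, §II.6 Theorem 3 (II.21) p0007:L138–163] -/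
def thm3Bound (T s ε K₀ K₀' K₀'' K₁ε KcT : ℝ) (p : ℕ) (φ : Fin (2 * p) → TestFn) : ℝ :=
  if p = 1 then K₀'' * testNormProduct2 φ * T ^ 2 * KcT *
      Real.exp (-(1 - ε) * lambdaT 0 T ^ (1 / s) * treeDistSets (fun i => tsupport (φ i)) ^ (1 / s))
  else if p = 2 then K₀' * testNormProduct2 φ * T ^ ((13 : ℝ) / 2) * KcT *
      Real.exp (-(1 - ε) * lambdaT 0 T ^ (1 / s) * treeDistSets (fun i => tsupport (φ i)) ^ (1 / s))
  else K₀ * testNormProduct2 φ * T ^ ((7 : ℝ) / 2 * p - 1 / 2) * (1 / (2 * (p : ℝ) - 4)) * K₁ε ^ p *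
      ((Nat.factorial p : ℕ) : ℝ) ^ 2 * KcT *
      Real.exp (-(1 - ε) * lambdaT 0 T ^ (1 / s) * treeDistSets (fun i => tsupport (φ i)) ^ (1 / s))

/-- **Theorem 3 (shape)** on a family `T ↦ data` (Λ₀ = 1, Gevrey index `s` of `u`): constants `K₁, K₂ > 0` (radius),
and for every `ε > 0` constants `K₀ > 0`, `K₀'(ε), K₀''(ε), K₁(ε) > 0` and a function `K(c,T) → 0` as `c → 0⁺` (each T),
such that for all `0 < T < K₁`, all `0 < c ≤ 1/(K₂|log(T/K₁)|)` and all admissible test functions: the series (II.15)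
converges at radius `c` uniformly in `Λ ∈ (0,1]`; the IR limit exists for `|λ| ≤ c`, is holomorphic on the open disc,
and obeys (II.21) (`thm3Bound`).  Predicate, NOT asserted. [cite: DisertoriRivasseau2000b, §II.6 Theorem 3 (II.20)–(II.22) p0007:L127–163] -/
def ThmII3Shape (s : ℝ) (D : ℝ → RenormalizedData) : Prop :=
  ∃ K₁ K₂ : ℝ, 0 < K₁ ∧ 0 < K₂ ∧ ∀ ε : ℝ, 0 < ε →
    ∃ (K₀ K₀' K₀'' K₁ε : ℝ) (Kc : ℝ → ℝ → ℝ), 0 < K₀ ∧ 0 < K₀' ∧ 0 < K₀'' ∧ 0 < K₁ε ∧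
      (∀ T : ℝ, 0 < T → Tendsto (fun c => Kc c T) (𝓝[>] 0) (𝓝 0)) ∧
      ∀ T : ℝ, 0 < T → T < K₁ → ∀ c : ℝ, 0 < c → c ≤ radiusOfT K₁ K₂ T →
        ∀ (p : ℕ), 1 ≤ p → ∀ φ : Fin (2 * p) → TestFn, (∀ i, IsTestFn (φ i)) →
          UnifAbsConv (fun Λ n => (D T).absTerm p Λ φ n) c ∧
          ∃ G : ℂ → ℂ, DifferentiableOn ℂ G (Metric.ball 0 c) ∧
            ∀ lam : ℂ, ‖lam‖ ≤ c →
              Tendsto (fun Λ : ℝ => (D T).gamma p Λ lam φ) (𝓝[>] 0) (𝓝 (G lam)) ∧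
                ‖G lam‖ ≤ thm3Bound T s ε K₀ K₀' K₀'' K₁ε (Kc c T) p φ

/-! ## Appendix A: the flow of the counterterm — H(Λ) and Lemmas 6, 7, 8 as hypothesis shapes (rows DR2.L6–L8) -/

/-- The data of Appendix A at one temperature (not constructed here): `sigmaIns δμ Λ' λ` stands for `Σ[δμ, C¹_{Λ'}](λ)`
— the 1PI two-point vertex function with at least one internal line, at external momentum `k_F`, of the theory with
bare counterterm `δμ`, propagator `C¹_{Λ'}` and coupling `λ` — and `deltaMu1 Λ λ` for the bare counterterm `δμ¹_Λ(λ)` of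
the theory with IR cutoff `Λ`. [cite: DisertoriRivasseau2000b, App. A (A.1)–(A.3) p0014:L72–99] -/
structure CountertermFlowData where
  /-- `Σ[δμ, C¹_{Λ'}](λ)`. -/
  sigmaIns : ℂ → ℝ → ℂ → ℂ
  /-- `δμ¹_Λ(λ)`. -/
  deltaMu1 : ℝ → ℂ → ℂ

namespace CountertermFlowData

variable (F : CountertermFlowData)

/-- The BPHZ fixed-point equation (A.1) at `(Λ, λ)`: `δμ¹_Λ(λ) = Σ[δμ¹_Λ(λ), C¹_Λ]` (⟺ δμ^Λ_Λ(λ) = 0).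
[cite: DisertoriRivasseau2000b, App. A (A.1) p0014:L88–96] -/
def BPHZ (Λ : ℝ) (lam : ℂ) : Prop := F.deltaMu1 Λ lam = F.sigmaIns (F.deltaMu1 Λ lam) Λ lam

/-- The effective constant (A.2): `δμ^{Λ'}_Λ(λ) = δμ¹_Λ(λ) − Σ[δμ¹_Λ(λ), C¹_{Λ'}]`, `Λ ≤ Λ' ≤ 1`.
[cite: DisertoriRivasseau2000b, App. A (A.2) p0014:L91–95] -/
def effConst (Λ Λ' : ℝ) (lam : ℂ) : ℂ := F.deltaMu1 Λ lam - F.sigmaIns (F.deltaMu1 Λ lam) Λ' lam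

/-- The induction hypothesis `H(Λ)` (A.4) at coupling `λ` with constant `K₁`: `|δμ^{Λ'}_Λ(λ)| ≤ K₁|λ|(Λ' − Λ)` for all
`Λ ≤ Λ' ≤ 1`. [cite: DisertoriRivasseau2000b, App. A (A.4) p0014:L150–151] -/
def HProp (K₁ Λ : ℝ) (lam : ℂ) : Prop :=
  ∀ Λ' : ℝ, Λ ≤ Λ' → Λ' ≤ 1 → ‖F.effConst Λ Λ' lam‖ ≤ K₁ * ‖lam‖ * (Λ' - Λ)

/-- **Lemma 6 (shape)** with constants `K₁, K₂` in the disc `|λ| ≤ c`: for `0 ≤ Λ ≤ 1`, if `H(Λ)` holds then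
`Λ ↦ δμ¹_Λ(λ)` is differentiable at `Λ` within `[0,1]` with `|(d/dΛ)δμ¹_Λ(λ)| ≤ K₂|λ|` («A ≤ K'λ, B ≤ 1/2, K₂ = 2K'»).
Predicate, NOT asserted. [cite: DisertoriRivasseau2000b, App. A Lemma 6 (A.5)–(A.7) p0014:L167–187] -/
def Lemma6Shape (c K₁ K₂ : ℝ) : Prop :=
  ∀ (Λ : ℝ) (lam : ℂ), 0 ≤ Λ → Λ ≤ 1 → ‖lam‖ ≤ c → F.HProp K₁ Λ lam →
    ∃ d : ℂ, HasDerivWithinAt (fun Λ₁ : ℝ => F.deltaMu1 Λ₁ lam) d (Set.Icc 0 1) Λ ∧ ‖d‖ ≤ K₂ * ‖lam‖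

/-- **Lemma 7 (shape)**: for `0 ≤ Λ ≤ Λ' ≤ 1`, if `H(Λ)` holds then `Λ ↦ δμ^{Λ'}_Λ(λ)` is differentiable at `Λ` within `[0, Λ']` with
`|(d/dΛ)δμ^{Λ'}_Λ(λ)| ≤ K₃|λ|` («K₂|λ|(1+|λ|) ≤ K₃|λ|»).  Predicate, NOT asserted.
[cite: DisertoriRivasseau2000b, App. A Lemma 7 p0015:L102–123] -/
def Lemma7Shape (c K₁ K₃ : ℝ) : Prop :=
  ∀ (Λ Λ' : ℝ) (lam : ℂ), 0 ≤ Λ → Λ ≤ Λ' → Λ' ≤ 1 → ‖lam‖ ≤ c → F.HProp K₁ Λ lam →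
    ∃ d : ℂ, HasDerivWithinAt (fun Λ₁ : ℝ => F.effConst Λ₁ Λ' lam) d (Set.Icc 0 Λ') Λ ∧ ‖d‖ ≤ K₃ * ‖lam‖

/-- **Lemma 8 (shape)**: if `|δμ^{Λ'}_Λ(λ)| ≤ K₁|λ|(Λ' − Λ)` holds for all `Λ' ≥ Λ'₀ = Λ + ε` (`Λ' ≤ 1`), then it holds at
`Λ'₀ − ε'` for all `ε' < ε` small enough.  Predicate, NOT asserted. [cite: DisertoriRivasseau2000b, App. A Lemma 8 p0015:L125–149] -/
def Lemma8Shape (c K₁ : ℝ) : Prop :=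
  ∀ (Λ ε : ℝ) (lam : ℂ), 0 ≤ Λ → 0 < ε → Λ + ε ≤ 1 → ‖lam‖ ≤ c →
    (∀ Λ' : ℝ, Λ + ε ≤ Λ' → Λ' ≤ 1 → ‖F.effConst Λ Λ' lam‖ ≤ K₁ * ‖lam‖ * (Λ' - Λ)) →
      ∃ ε₀ : ℝ, 0 < ε₀ ∧ ∀ ε' : ℝ, 0 < ε' → ε' < ε → ε' ≤ ε₀ →
        ‖F.effConst Λ (Λ + ε - ε') lam‖ ≤ K₁ * ‖lam‖ * (Λ + ε - ε' - Λ)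

end CountertermFlowData

/-! ## §II.7 Lemma 3 (row DR2.L3): the tangential derivative of a rotation-invariant two-point function vanishes — PROVED -/

/-- **Lemma 3**, momentum-space core («ĝ(k) depends only on the zero component k₀ and on the module of the spatial
vector ρ: ∂_θ ĝ(k) = 0 ∀θ», hence «[∂ĝ/∂k_t(r₂)]_{k=−r₂} = 0»): if `g(k₀, k⃗)` depends on `k⃗` only through `|k⃗|` and is
differentiable at `k = (k₀, ρ(cos θ, sin θ))`, its derivative there along the tangential direction `(0, (−sin θ, cos θ))`
vanishes.  Proved: `t ↦ g(k₀, ρ(cos(θ+t), sin(θ+t)))` is constant.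
[cite: DisertoriRivasseau2000b, §II.7 Lemma 3 (II.30)–(II.35) p0008:L175–183, p0009:L1–42] -/
theorem tangentialDeriv_eq_zero_of_rotationInvariant (g : Mom → ℂ)
    (hrot : ∀ (k₀ : ℝ) (k k' : Fin 2 → ℝ), k 0 ^ 2 + k 1 ^ 2 = k' 0 ^ 2 + k' 1 ^ 2 → g (k₀, k) = g (k₀, k'))
    (k₀ ρ θ : ℝ) (hg : DifferentiableAt ℝ g (k₀, ![ρ * Real.cos θ, ρ * Real.sin θ])) :
    fderiv ℝ g (k₀, ![ρ * Real.cos θ, ρ * Real.sin θ]) (0, ![-(ρ * Real.sin θ), ρ * Real.cos θ]) = 0 := by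
  -- the circle through the point, parametrised by the angle
  set γ : ℝ → Mom := fun t => (k₀, ![ρ * Real.cos (θ + t), ρ * Real.sin (θ + t)]) with hγ
  have hγ0 : γ 0 = (k₀, ![ρ * Real.cos θ, ρ * Real.sin θ]) := by simp [hγ]
  -- `g ∘ γ` is constant
  have hconst : ∀ t, g (γ t) = g (γ 0) := by
    intro t
    simp only [hγ, add_zero]
    refine hrot k₀ _ _ ?_
    simp only [Matrix.cons_val_zero, Matrix.cons_val_one]
    nlinarith [Real.sin_sq_add_cos_sq (θ + t), Real.sin_sq_add_cos_sq θ]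
  -- derivative of γ at 0
  have hγ' : HasDerivAt γ ((0 : ℝ), ![-(ρ * Real.sin θ), ρ * Real.cos θ]) 0 := by
    refine HasDerivAt.prodMk (hasDerivAt_const _ _) ?_
    rw [hasDerivAt_pi]
    intro i
    fin_cases i
    · have h := ((Real.hasDerivAt_cos (θ + 0)).comp 0 ((hasDerivAt_id 0).const_add θ)).const_mul ρ
      simpa using h
    · have h := ((Real.hasDerivAt_sin (θ + 0)).comp 0 ((hasDerivAt_id 0).const_add θ)).const_mul ρ
      simpa using h
  -- chain rule: derivative of the constant map `g ∘ γ` at 0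
  have hcomp : HasDerivAt (g ∘ γ) (fderiv ℝ g (γ 0) ((0 : ℝ), ![-(ρ * Real.sin θ), ρ * Real.cos θ])) 0 := by
    have hg' : HasFDerivAt g (fderiv ℝ g (γ 0)) (γ 0) := by rw [hγ0]; exact hg.hasFDerivAt
    exact hg'.comp_hasDerivAt 0 hγ'
  have hzero : HasDerivAt (g ∘ γ) 0 0 := by
    have : (g ∘ γ) = fun _ => g (γ 0) := funext fun t => hconst t
    rw [this]
    exact hasDerivAt_const _ _
  rw [← hγ0]
  exact hcomp.unique hzero

/-! ## App. B1 Lemma 9 (row DR2.L9): arch systems do not develop a factorial -/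

/-- The printed recursion `a₁ = m₁`, `a_r(s₁,…,s_{r−1}) = m_r + s_{r−1} a_{r−1}(s₁,…,s_{r−2})` (0-indexed: `a 0 = m 0`,
`a (r+1) = m (r+1) + s r · a r`). [cite: DisertoriRivasseau2000b, App. B1 Lemma 9 (B.9) p0016:L131–134] -/
def archA (m s : ℕ → ℝ) : ℕ → ℝ
  | 0 => m 0
  | r + 1 => m (r + 1) + s r * archA m s r

/-- **Lemma 9** («The sum over all possible arch systems … does not develop a factorial»), in the closed form the printed
proof reduces it to: for `q ≥ 1` and `m_r ≥ 0`, `∫_{[0,1]^q} ∏_{r=1}^{q} a_r(s) ds ≤ e^{Σ_r m_r}`.  Named fact, not asserted.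
[cite: DisertoriRivasseau2000b, App. B1 Lemma 9 (B.8)–(B.10) p0016:L116–140] -/
def Lemma9ArchSystems : Prop :=
  ∀ (q : ℕ) (m : ℕ → ℝ), 1 ≤ q → (∀ r, 0 ≤ m r) →
    ∫ s in Set.pi Set.univ (fun _ : Fin q => Set.Icc (0 : ℝ) 1),
        ∏ r ∈ Finset.range q, archA m (fun j => if h : j < q then s ⟨j, h⟩ else 0) r
      ≤ Real.exp (∑ r ∈ Finset.range q, m r)

end Literature.MathematicalPhysics.QuantumLattice.FermiRG.DR2000

end
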